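import Literature.Geometry.Lorentzian.EndNormSqConvex
import HarnessLib

/-!
# Closed minimal surfaces do not reach far out into an asymptotically Schwarzschildean end

Schoen–Yau, Comm. Math. Phys. 65 (1979), §2 Step 2, (2.4), p. 50: *"there exists `τ₁ > τ₀` so
that the function `|y|²` is a convex function for `|y| ≥ τ₁`. Since `S_σ ∩ N_{k'}` is a compact
minimal submanifold of `N_{k'}`, and `∂(S_σ ∩ N_{k'}) ⊆ ∂N_{k'}`, we may apply the maximum
principle to conclude that `S_σ ∩ N_{k'} ⊆ B_{τ₁}(0)`"* — the maximum principle for the convex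
function `|y|²` confines compact minimal surfaces to a fixed coordinate ball (up to their
boundary). `EndNormSqConvex.lean` proves the pointwise form (`SchoenYau.not_isLocalMax_normSq`:
no local maximum of `|x ∘ F|²` at a point far out of an immersed minimal surface). This file draws
the global conclusion for **closed** surfaces:

* `SchoenYau.norm_coord_le_of_compact_minimal` — there is `ρ₁ > 0` such that every **compact**
  (boundaryless) spacelike immersed minimal surface `F : S → X` with a smooth unit normal field
  satisfies `‖x(F y)‖ ≤ ρ₁` for all `y ∈ S`: a closed minimal surface lies in the union of the
  compact core and the coordinate ball `{‖x‖ ≤ ρ₁}` of the end. (Maximise the continuous function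
  `χ(‖x‖ − R₁)·‖x‖² ∘ F` — a smooth cut-off version of `|x|²`, which is not globally continuous —
  over the compact `S`; at a maximum point beyond `ρ₁` it is locally `|x ∘ F|²`, contradicting
  `not_isLocalMax_normSq`.)

This is the form in which the convexity of `|y|²` is used for closed minimal surfaces in
asymptotically flat ends (e.g. horizons and minimal spheres lie in a fixed compact set).
Everything is proved; no definitions, no named facts.

## References

* R. Schoen, S.-T. Yau, *On the proof of the positive mass conjecture in general relativity*,
  Comm. Math. Phys. 65 (1979) 45–76, §2 Step 2, (2.4) (p. 50). [SchoenYauPMT1979]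
-/

noncomputable section

open Bundle Set Function Filter Metric
open scoped Manifold ContDiff Topology

namespace Literature.Geometry.Lorentzian

namespace SchoenYau

variable {X : Type} [TopologicalSpace X] [ChartedSpace E3 X] [IsManifold (𝓡 3) ∞ X]
  (e : AFEnd X) (D : InitialDataSet (𝓡 3) X) [D.metric.HasLeviCivita]

/-- **Schoen–Yau 1979, (2.4): a closed minimal surface stays within a fixed coordinate radius.**
Let `(X, h, k)` be `3`-dimensional initial data whose end `e` has the expansion (1.1)
(`IsAsymptoticallySchwarzschild e D M 2`, any `M`). There is `ρ₁ > 0` such that for every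
**compact** surface `S` (a `2`-manifold without boundary), every spacelike immersion `F : S → X`
with a smooth unit normal field and mean curvature `H ≡ 0`, and every `y ∈ S`,
`‖x(F y)‖ ≤ ρ₁` (`x = coord`, extended by `0` off the end). Printed (p. 50): "the function `|y|²`
is a convex function for `|y| ≥ τ₁` … we may apply the maximum principle to conclude that
`S_σ ∩ N_{k'} ⊆ B_{τ₁}(0)`". Proof: the smooth cut-off version `φ_c = χ(‖x‖ − R₁)‖x‖²` of `|x|²`
(`χ` Mathlib's `smoothTransition`, `R₁ = R + 1`) is continuous on `X`, so `φ_c ∘ F` attains its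
maximum on the compact `S` at some `y₁`; if some point had `‖x(F y)‖ > ρ₁ = max ρ₀ (R₁ + 1)` then
`‖x(F y₁)‖ > ρ₁` too (`0 ≤ χ ≤ 1`, `χ = 1` beyond `R₁ + 1`), near `F y₁` the cut-off is `1`, and
`y₁` would be a local maximum of `|x ∘ F|²` beyond the radius `ρ₀` of `not_isLocalMax_normSq`.
[cite: SchoenYauPMT1979, §2 Step 2, (2.4) (p. 50)] -/
theorem norm_coord_le_of_compact_minimal {M : ℝ} (hAS : IsAsymptoticallySchwarzschild e D M 2) :
    ∃ ρ₁ : ℝ, 0 < ρ₁ ∧ ∀ (S : Type) [TopologicalSpace S]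
      [ChartedSpace (EuclideanSpace ℝ (Fin 2)) S] [IsManifold (𝓡 2) ∞ S] [CompactSpace S]
      (F : S → X) (hpb : PseudoRiemannianMetric.contMDiff_pullbackBilin (𝓡 3) X (𝓡 2) S ∞)
      (hfi : D.metric.IsSpacelikeImmersion (𝓡 2) F) (ν : NormalField (𝓡 3) F),
      ContMDiff (𝓡 2) (𝓡 3).tangent ∞
          (fun y ↦ (TotalSpace.mk' E3 (F y) (ν y) : TangentBundle (𝓡 3) X)) →
      D.metric.IsUnitNormal (𝓡 2) F ν 1 →
      (∀ y, D.metric.meanCurvature F hpb hfi ν y = 0) →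
      ∀ y : S, ‖e.coord (F y)‖ ≤ ρ₁ := by
  obtain ⟨ρ₀, hρ₀, hmax⟩ := not_isLocalMax_normSq e D hAS
  set R₁ : ℝ := e.R + 1 with hR₁
  have hR₁' : e.R < R₁ := by rw [hR₁]; linarith
  have hRpos := e.R_pos
  refine ⟨max ρ₀ (R₁ + 1), lt_max_of_lt_left hρ₀, ?_⟩
  intro S _ _ _ _ F hpb hfi ν hν hun hmin y
  by_contra hyc
  have hy : max ρ₀ (R₁ + 1) < ‖e.coord (F y)‖ := not_le.1 hyc
  have hyR : R₁ + 1 < ‖e.coord (F y)‖ := (le_max_right _ _).trans_lt hy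
  -- the smooth cut-off version of `|x|²`
  set φc : X → ℝ := fun p ↦ Real.smoothTransition (‖e.coord p‖ - R₁) * ‖e.coord p‖ ^ 2
    with hφcdef
  have hφc : ContMDiff (𝓡 3) 𝓘(ℝ, ℝ) ∞ φc := by
    intro q
    by_cases hq : q ∈ ((↑) : e.U → X) '' (e.chart ⁻¹' {x | R₁ ≤ ‖(x : E3)‖})
    · obtain ⟨hqU, -⟩ := e.mem_image_preimage_le_norm_iff.1 hq
      exact ((e.contMDiff_endCutoff hR₁') q).mul (e.contMDiffAt_normSq_coord hqU)
    · refine (contMDiffAt_const (c := (0 : ℝ))).congr_of_eventuallyEq ?_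
      filter_upwards [e.endCutoff_eventuallyEq_zero hR₁' hq] with p hp
      change Real.smoothTransition (‖e.coord p‖ - R₁) * ‖e.coord p‖ ^ 2 = (0 : ℝ)
      rw [hp, zero_mul]
  -- `φc ≤ |x|²` everywhere, with equality beyond `R₁ + 1`
  have hφc_le : ∀ p, φc p ≤ ‖e.coord p‖ ^ 2 := fun p ↦
    mul_le_of_le_one_left (sq_nonneg _) (Real.smoothTransition.le_one _)
  have hφcy : φc (F y) = ‖e.coord (F y)‖ ^ 2 := by
    change Real.smoothTransition (‖e.coord (F y)‖ - R₁) * ‖e.coord (F y)‖ ^ 2 = _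
    rw [e.endCutoff_eq_one hyR.le, one_mul]
  -- the maximum of the continuous `φc ∘ F` on the compact `S`
  have hFs : ContMDiff (𝓡 2) (𝓡 3) ∞ F := hfi.contMDiff_self
  have hψc : Continuous fun z ↦ φc (F z) := hφc.continuous.comp hFs.continuous
  obtain ⟨y₁, -, hy₁⟩ := isCompact_univ.exists_isMaxOn ⟨y, mem_univ y⟩ hψc.continuousOn
  have hge : ‖e.coord (F y)‖ ^ 2 ≤ ‖e.coord (F y₁)‖ ^ 2 :=
    (hφcy.symm.le.trans (hy₁ (mem_univ y))).trans (hφc_le (F y₁))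
  have hnorm : ‖e.coord (F y)‖ ≤ ‖e.coord (F y₁)‖ :=
    le_of_sq_le_sq (by nlinarith [norm_nonneg (e.coord (F y))]) (norm_nonneg _)
  have hy₁ρ : ρ₀ < ‖e.coord (F y₁)‖ := ((le_max_left _ _).trans_lt hy).trans_le hnorm
  have hy₁R : R₁ + 1 < ‖e.coord (F y₁)‖ := hyR.trans_le hnorm
  -- `F y₁` lies far out in the end, where `φc = |x|²`
  have hU₁ : F y₁ ∈ e.U := by
    by_contra hcon
    rw [e.coord_of_not_mem hcon, norm_zero] at hy₁R
    linarith
  have hfar₁ : F y₁ ∈ e.far (R₁ + 1) := e.mem_far_iff_coord.2 ⟨hU₁, hy₁R⟩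
  have hloc : φc =ᶠ[𝓝 (F y₁)] fun p ↦ ‖e.coord p‖ ^ 2 := by
    filter_upwards [e.endCutoff_eventuallyEq_one hfar₁] with p hp
    change Real.smoothTransition (‖e.coord p‖ - R₁) * ‖e.coord p‖ ^ 2 = ‖e.coord p‖ ^ 2
    rw [hp, one_mul]
  have hlocS : (fun z ↦ φc (F z)) =ᶠ[𝓝 y₁] fun z ↦ ‖e.coord (F z)‖ ^ 2 :=
    (hFs.continuous.continuousAt (x := y₁)).eventually hloc
  -- a global maximum is a local maximum; contradiction with `not_isLocalMax_normSq`
  have hlm : IsLocalMax (fun z ↦ φc (F z)) y₁ := hy₁.isLocalMax univ_mem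
  have hlm' : IsLocalMax (fun z ↦ ‖e.coord (F z)‖ ^ 2) y₁ := hlocS.isLocalMax_iff.1 hlm
  exact hmax S F hpb hfi ν hν hun hmin y₁ hy₁ρ hlm'

end SchoenYau

end Literature.Geometry.Lorentzian

end
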